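import Summits.CriticalPhenomena.SAWScalingLimit.Theorems.SAWDefectDecoherenceBoundaryClosureRDevelopingMapsCompactFlat
import Summits.CriticalPhenomena.SAWScalingLimit.Theorems.SAWDefectDecoherenceBoundaryClosureRBoundaryDataTransferArmsPrep
import HarnessLib

/-!
# Boundary data transfer, VII: the lattice frame of the limit passage

Route `SAWDefectDecoherence`, crux `BoundaryClosureR` (stmt-CriticalPhenomena-14004), line
`pick-half-plane`, stub `stub_engineBoundaryData` (r13; = seat -1's `stub_boundaryDataTransfer`):
every engine limit `h` (the locally uniform limit of the normalised developing maps
`h_δ(s) = δ (H s − H s_b)/F(b δ)` on `U = (carrier ∪ flat pieces) ∖ {x}`) satisfies the hypotheses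
(I1)–(I4) of the landed `pickEngine_stage2`.  This file is the lattice-side frame shared by the
three limit passages (arms + wedge, divergence, flat regularity):

* `exists_frequently_of_eventually_exists` — pigeonhole along a filter over a finite index type;
* `flat_window` / `boundaryDataTransfer_flatWindow` (registered) — under the lattice pin, every
  column of the real window `|δ(k + μ/2) − re c| ≤ R' < R` carries an exact flat floor cell;
* `im_rot_eq_zero_of_forall_approx` — a vector approximable by the line `e^{iθ}ℝ` lies on it;
* `norm_scaled_site_sub_le`, `floorColumn_near`, `re/im_scaled_hexMidpoint_floorEdge` — floor
  sites and floor midpoints under a real abscissa;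
* `rootFrame_near`, `gateFrame_near`, `eventually_rootGateFrame` — eventually the root is a floor
  dart `floorEdge ka (mr δ)` near `x` and the normaliser a floor dart `floorEdge kb (m δ) ≠` root,
  joined by a walk of winding `π + 2πj`;
* `frequently_armClass` — ONE class `j mod 8` is hit frequently along any mesh sequence, so the
  engine phase `θ = π/8 − (3/8)W_b` and the wedge direction `ω = −e^{i(5/8)W_b}` are frequently
  the constants of that class.
-/

noncomputable section

open scoped Topology
open Filter Set
open Complex (I exp)
open Literature.Probability.LatticeModels Literature.Probability.RandomPlanarGeometry
open Literature.Probability.RandomPlanarGeometry.SAW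
open Summit.CriticalPhenomena.SAWScalingLimit.Theorems.PickHalfPlane.RootWedge
open Summit.CriticalPhenomena.SAWScalingLimit.Theorems.PickHalfPlane.DevelopingMaps
open Summit.CriticalPhenomena.SAWScalingLimit.Theorems.PickHalfPlane.BoundaryExactness

namespace Summit.CriticalPhenomena.SAWScalingLimit.Theorems.PickHalfPlane.BoundaryDataTransfer

/-! ### Pigeonhole along a filter -/

/-- **Pigeonhole along a filter**: if eventually some index of a finite type is good, then one
index is good frequently. [folklore] -/
theorem exists_frequently_of_eventually_exists {α ι : Type*} [Finite ι] {l : Filter α} [l.NeBot]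
    {P : α → ι → Prop} (h : ∀ᶠ a in l, ∃ i, P a i) : ∃ i, ∃ᶠ a in l, P a i := by
  by_contra hc
  simp only [not_exists, Filter.not_frequently] at hc
  have hall : ∀ᶠ a in l, ∀ i, ¬P a i := Filter.eventually_all.2 hc
  obtain ⟨a, ⟨i, hi⟩, ha⟩ := (h.and hall).exists
  exact ha i hi

/-! ### Flat windows under the lattice pin -/

/-- The four faces around the floor site `![k, μ]` used by the flat-floor clauses have centres
within `2` of that site. [folklore] -/
theorem norm_hexCenter_sub_floorSite_le (k μ : ℤ) :
    ‖hexCenter (upFace k μ) - triEmbed ![k, μ]‖ ≤ 2 ∧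
    ‖hexCenter (belowFace k μ) - triEmbed ![k, μ]‖ ≤ 2 ∧
    ‖hexCenter (((![k, μ], 1) : HexVertex)) - triEmbed ![k, μ]‖ ≤ 2 ∧
    ‖hexCenter (((![k - 1, μ], 1) : HexVertex)) - triEmbed ![k, μ]‖ ≤ 2 := by
  have h1 : ∀ (f : HexVertex) (s : Site 2), s ∈ hexFaceVertices f → ‖triEmbed s - triEmbed ![k, μ]‖ ≤ 1 →
      ‖hexCenter f - triEmbed ![k, μ]‖ ≤ 2 := by
    intro f s hs hd
    calc ‖hexCenter f - triEmbed ![k, μ]‖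
        ≤ ‖hexCenter f - triEmbed s‖ + ‖triEmbed s - triEmbed ![k, μ]‖ := norm_sub_le_norm_sub_add_norm_sub _ _ _
      _ ≤ 1 + 1 := add_le_add (by rw [norm_sub_rev]; exact norm_triEmbed_sub_hexCenter_le hs) hd
      _ = 2 := by norm_num
  have hsucc : triEmbed ![k + 1, μ] = triEmbed ![k, μ] + 1 := by
    have : (![k + 1, μ] : Site 2) = ![k, μ] + Pi.single 0 1 := by ext i; fin_cases i <;> simp
    rw [this, triEmbed_add, triEmbed_single_zero]
  refine ⟨h1 _ _ (floorSite_mem_upFace k μ) (by simp), h1 _ _ (floorSite_mem_belowFace k μ) (by simp),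
    h1 _ ![k + 1, μ] ?_ (by rw [hsucc]; simp), h1 _ ![k, μ] ?_ (by simp)⟩
  · rw [mem_hexFaceVertices_one]
    exact Or.inl (by ext i; fin_cases i <;> simp)
  · rw [mem_hexFaceVertices_one]
    exact Or.inl (by ext i; fin_cases i <;> simp)

/-- **Flat windows under the lattice pin.**  Frame: a lattice pin with row threshold `μ δ` inside
`ball c R`, a boundary mid-edge `d δ` with `δ·mid(d δ) → c`.  For `R' < R`, eventually as
`δ → 0+`, every column `k` of the real window `|δ(k + μ δ/2) − re c| ≤ R'` carries an exact flat
floor cell: `upFace k (μ δ) ∈ Λ δ`, `belowFace k (μ δ) ∉ Λ δ`, and both down-faces of the row over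
it are in `Λ δ` (the floor line is within `o(1)` of `im c`, so the four centres lie in `ball c R`).
[cite: DuminilCopinSmirnov2012, §3 (the boundary part α of the strip)] -/
theorem flat_window {Λ : ℝ → Finset HexVertex} {μ : ℝ → ℤ} {R R' : ℝ} {c : ℂ} {d : ℝ → Sym2 HexVertex}
    (hR' : R' < R)
    (hpin : ∀ᶠ δ : ℝ in 𝓝[>] 0, ∀ v : HexVertex,
      (δ : ℂ) * hexCenter v ∈ Metric.ball c R → (v ∈ Λ δ ↔ μ δ ≤ v.1 1))
    (hbd : ∀ᶠ δ : ℝ in 𝓝[>] 0, d δ ∈ hexDomainBoundary (Λ δ))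
    (hlim : Tendsto (fun δ : ℝ => (δ : ℂ) * hexMidpoint (d δ)) (𝓝[>] 0) (𝓝 c)) :
    ∀ᶠ δ : ℝ in 𝓝[>] 0, ∀ k : ℤ, |δ * (k + μ δ / 2) - c.re| ≤ R' →
      upFace k (μ δ) ∈ Λ δ ∧ belowFace k (μ δ) ∉ Λ δ ∧ ((![k, μ δ], 1) : HexVertex) ∈ Λ δ ∧
        ((![k - 1, μ δ], 1) : HexVertex) ∈ Λ δ := by
  by_cases hR : 0 < R
  swap
  · -- an empty ball: the pin is vacuous only if `R ≤ 0`; then the window is empty too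
    filter_upwards [self_mem_nhdsWithin] with δ (hδ : 0 < δ) k hk
    exfalso
    have : |δ * (k + μ δ / 2) - c.re| < 0 := lt_of_le_of_lt hk (by linarith [not_lt.1 hR])
    exact absurd this (not_lt.2 (abs_nonneg _))
  set ε : ℝ := (R - R') / 4 with hε
  have hε0 : 0 < ε := by rw [hε]; linarith
  have hδev : ∀ᶠ δ : ℝ in 𝓝[>] 0, δ ∈ Set.Ioo 0 ε := Ioo_mem_nhdsGT hε0
  have hheight : ∀ᶠ δ : ℝ in 𝓝[>] 0, dist (δ * (μ δ : ℝ) * (Real.sqrt 3 / 2)) c.im < ε :=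
    Metric.tendsto_nhds.1 (GateMass.tendsto_floorHeight hR hpin hbd hlim) _ hε0
  filter_upwards [hpin, hδev, hheight] with δ hpinδ ⟨hδ0, hδε⟩ hht k hk
  rw [Real.dist_eq] at hht
  set M : ℤ := μ δ with hM
  -- the floor site `![k, M]` scaled is within `R' + ε` of `c`
  have hsite : ‖(δ : ℂ) * triEmbed ![k, M] - c‖ ≤ R' + ε := by
    have hre : ((δ : ℂ) * triEmbed ![k, M] - c).re = δ * (k + M / 2) - c.re := by
      rw [Complex.sub_re, re_real_mul, re_triEmbed_vec2]; ring
    have him : ((δ : ℂ) * triEmbed ![k, M] - c).im = δ * (M : ℝ) * (Real.sqrt 3 / 2) - c.im := by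
      rw [Complex.sub_im, im_real_mul, im_triEmbed_vec2]; ring
    calc ‖(δ : ℂ) * triEmbed ![k, M] - c‖
        ≤ |((δ : ℂ) * triEmbed ![k, M] - c).re| + |((δ : ℂ) * triEmbed ![k, M] - c).im| :=
          Complex.norm_le_abs_re_add_abs_im _
      _ ≤ R' + ε := by rw [hre, him]; exact add_le_add hk hht.le
  have hball : ∀ f : HexVertex, ‖hexCenter f - triEmbed ![k, M]‖ ≤ 2 →
      (δ : ℂ) * hexCenter f ∈ Metric.ball c R := by
    intro f hf
    rw [Metric.mem_ball, dist_eq_norm]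
    have h1 : ‖(δ : ℂ) * hexCenter f - (δ : ℂ) * triEmbed ![k, M]‖ ≤ 2 * δ := by
      rw [norm_smul_sub hδ0.le]; nlinarith
    calc ‖(δ : ℂ) * hexCenter f - c‖
        ≤ ‖(δ : ℂ) * hexCenter f - (δ : ℂ) * triEmbed ![k, M]‖ + ‖(δ : ℂ) * triEmbed ![k, M] - c‖ :=
          norm_sub_le_norm_sub_add_norm_sub _ _ _
      _ ≤ 2 * δ + (R' + ε) := add_le_add h1 hsite
      _ < R := by rw [hε] at hδε ⊢; linarith
  obtain ⟨g1, g2, g3, g4⟩ := norm_hexCenter_sub_floorSite_le k M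
  refine ⟨(hpinδ _ (hball _ g1)).2 ?_, fun h => ?_, (hpinδ _ (hball _ g3)).2 ?_,
    (hpinδ _ (hball _ g4)).2 ?_⟩
  · show M ≤ (upFace k M).1 1; unfold upFace; simp
  · have := (hpinδ _ (hball _ g2)).1 h
    unfold belowFace at this
    simp at this
  · simp
  · simp

/-- **Registered helper `boundaryDataTransfer_flatWindow`** (crux stmt-CriticalPhenomena-14004, line
`pick-half-plane`, stub `stub_boundaryDataTransfer`/`stub_engineBoundaryData`): flat windows under
the lattice pin, ∀-closed (`flat_window`). [cite: DuminilCopinSmirnov2012, §3 (the boundary part α of the strip)] -/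
theorem boundaryDataTransfer_flatWindow : ∀ (Λ : ℝ → Finset HexVertex) (μ : ℝ → ℤ) (R R' : ℝ) (c : ℂ) (d : ℝ → Sym2 HexVertex), 0 < R → R' < R → (∀ᶠ δ : ℝ in 𝓝[>] 0, ∀ v : HexVertex, (δ : ℂ) * hexCenter v ∈ Metric.ball c R → (v ∈ Λ δ ↔ μ δ ≤ v.1 1)) → (∀ᶠ δ : ℝ in 𝓝[>] 0, d δ ∈ hexDomainBoundary (Λ δ)) → Tendsto (fun δ : ℝ => (δ : ℂ) * hexMidpoint (d δ)) (𝓝[>] 0) (𝓝 c) → ∀ᶠ δ : ℝ in 𝓝[>] 0, ∀ k : ℤ, |δ * (k + μ δ / 2) - c.re| ≤ R' → upFace k (μ δ) ∈ Λ δ ∧ belowFace k (μ δ) ∉ Λ δ ∧ ((![k, μ δ], 1) : HexVertex) ∈ Λ δ ∧ ((![k - 1, μ δ], 1) : HexVertex) ∈ Λ δ :=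
  fun _ _ _ _ _ _ _ hR' hpin hbd hlim => flat_window hR' hpin hbd hlim


/-! ### Lines: closure under approximation -/

/-- **A vector approximable by the line `e^{iθ}ℝ` lies on it**: if for every `ε > 0` some
`e^{iθ} t` is within `ε` of `v`, then `Im(e^{−iθ} v) = 0`. [folklore] -/
theorem im_rot_eq_zero_of_forall_approx {θ : ℝ} {v : ℂ}
    (h : ∀ ε : ℝ, 0 < ε → ∃ t : ℝ, ‖v - exp ((θ : ℂ) * I) * t‖ ≤ ε) :
    (exp (-((θ : ℂ) * I)) * v).im = 0 := by
  by_contra hne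
  have hpos : 0 < |(exp (-((θ : ℂ) * I)) * v).im| := abs_pos.2 hne
  obtain ⟨t, ht⟩ := h (|(exp (-((θ : ℂ) * I)) * v).im| / 2) (by positivity)
  have hrot : ‖exp (-((θ : ℂ) * I)) * (v - exp ((θ : ℂ) * I) * t)‖ = ‖v - exp ((θ : ℂ) * I) * t‖ := by
    rw [norm_mul, show -((θ : ℂ) * I) = ((-θ : ℝ) : ℂ) * I by push_cast; ring,
      Complex.norm_exp_ofReal_mul_I, one_mul]
  have him : (exp (-((θ : ℂ) * I)) * (v - exp ((θ : ℂ) * I) * t)).im = (exp (-((θ : ℂ) * I)) * v).im := by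
    rw [mul_sub, Complex.sub_im, ← mul_assoc, ← Complex.exp_add,
      show -((θ : ℂ) * I) + (θ : ℂ) * I = 0 by ring, Complex.exp_zero, one_mul, Complex.ofReal_im,
      sub_zero]
  have key := Complex.abs_im_le_norm (exp (-((θ : ℂ) * I)) * (v - exp ((θ : ℂ) * I) * t))
  rw [him, hrot] at key
  linarith

/-- **Registered helper `boundaryDataTransfer_lineClosure`** (crux stmt-CriticalPhenomena-14004,
line `pick-half-plane`, stub `stub_engineBoundaryData`, closedness of the arm lines of (I1)/(I4)):
a vector approximable by points of `e^{iθ}ℝ` lies on that line, ∀-closed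
(`im_rot_eq_zero_of_forall_approx`). [folklore] -/
theorem boundaryDataTransfer_lineClosure : ∀ (θ : ℝ) (v : ℂ), (∀ ε : ℝ, 0 < ε → ∃ t : ℝ, ‖v - Complex.exp ((θ : ℂ) * Complex.I) * t‖ ≤ ε) → (Complex.exp (-((θ : ℂ) * Complex.I)) * v).im = 0 :=
  fun _ _ h => im_rot_eq_zero_of_forall_approx h

/-! ### Floor sites under a real abscissa -/

/-- Distance of a scaled site to a point through real and imaginary parts. [folklore] -/
theorem norm_scaled_site_sub_le (δ : ℝ) (a M : ℤ) (w : ℂ) :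
    ‖(δ : ℂ) * triEmbed ![a, M] - w‖ ≤ |δ * (a + M / 2) - w.re| + |δ * (M : ℝ) * (Real.sqrt 3 / 2) - w.im| := by
  have hre : ((δ : ℂ) * triEmbed ![a, M] - w).re = δ * (a + M / 2) - w.re := by
    rw [Complex.sub_re, re_real_mul, re_triEmbed_vec2]; ring
  have him : ((δ : ℂ) * triEmbed ![a, M] - w).im = δ * (M : ℝ) * (Real.sqrt 3 / 2) - w.im := by
    rw [Complex.sub_im, im_real_mul, im_triEmbed_vec2]; ring
  have := Complex.norm_le_abs_re_add_abs_im ((δ : ℂ) * triEmbed ![a, M] - w)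
  rwa [hre, him] at this

/-- **The floor column under a real abscissa**: for `δ > 0`, the column `a = ⌊u/δ − M/2⌋` has
`u − δ < δ(a + M/2) ≤ u`. [folklore] -/
theorem floorColumn_near {δ : ℝ} (hδ : 0 < δ) (u : ℝ) (M : ℤ) :
    u - δ < δ * (⌊u / δ - M / 2⌋ + M / 2) ∧ δ * (⌊u / δ - M / 2⌋ + M / 2) ≤ u := by
  have hk1 : ((⌊u / δ - M / 2⌋ : ℤ) : ℝ) ≤ u / δ - M / 2 := Int.floor_le _
  have hk2 : u / δ - M / 2 < ((⌊u / δ - M / 2⌋ : ℤ) : ℝ) + 1 := Int.lt_floor_add_one _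
  have e1 := mul_le_mul_of_nonneg_left hk1 hδ.le
  have e2 := mul_lt_mul_of_pos_left hk2 hδ
  rw [mul_sub, mul_div_cancel₀ _ hδ.ne'] at e1 e2
  constructor <;> nlinarith

/-- **A floor site under a point near the floor line**: if the floor line `im = δ M √3/2` is
within `ε` of `im w`, the floor site of column `⌊re w/δ − M/2⌋` scales to within `δ + ε` of `w`.
[folklore] -/
theorem norm_floorSite_sub_le {δ : ℝ} (hδ : 0 < δ) (M : ℤ) (w : ℂ) {ε : ℝ}
    (hht : |δ * (M : ℝ) * (Real.sqrt 3 / 2) - w.im| < ε) :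
    ‖(δ : ℂ) * triEmbed ![⌊w.re / δ - M / 2⌋, M] - w‖ ≤ δ + ε := by
  have h1 := norm_scaled_site_sub_le δ ⌊w.re / δ - M / 2⌋ M w
  have h2 := floorColumn_near hδ w.re M
  have h3 : |δ * (⌊w.re / δ - M / 2⌋ + M / 2) - w.re| ≤ δ := by
    rw [abs_le]; constructor <;> linarith [h2.1, h2.2]
  linarith [hht.le]

/-- The real part of the scaled midpoint of a floor dart: `δ(k + M/2) + δ/2`. [folklore] -/
theorem re_scaled_hexMidpoint_floorEdge (δ : ℝ) (k M : ℤ) :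
    ((δ : ℂ) * hexMidpoint (floorEdge k M)).re = δ * (k + M / 2) + δ / 2 := by
  rw [hexMidpoint_floorEdge, re_real_mul, Complex.add_re, re_triEmbed_vec2]
  simp; ring

/-- The imaginary part of the scaled midpoint of a floor dart: `δ M √3/2`. [folklore] -/
theorem im_scaled_hexMidpoint_floorEdge (δ : ℝ) (k M : ℤ) :
    ((δ : ℂ) * hexMidpoint (floorEdge k M)).im = δ * (M : ℝ) * (Real.sqrt 3 / 2) := by
  rw [hexMidpoint_floorEdge, im_real_mul, Complex.add_im, im_triEmbed_vec2]
  simp; ring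

/-- A floor site over a cell of `Λ` is a lattice site. [folklore] -/
theorem isLatticeSite_floorSite {Λ : Finset HexVertex} {a M : ℤ} (h : upFace a M ∈ Λ) :
    IsLatticeSite Λ ![a, M] :=
  ⟨upFace a M, h, floorSite_mem_upFace a M⟩

/-- **Window sums are dominated by column sums**: if every column of the (floor-dart) window
`{k | δ·mid(floorEdge k M) ∈ S}` lies in `[a', a)`, then for nonnegative weights the window `∑ᶠ` is
at most the sum over `Ico a' a`. [folklore] -/
theorem finsum_window_le_sum_Ico {δ : ℝ} {M : ℤ} {S : Set ℂ} {Z : Sym2 HexVertex → ℝ}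
    (hZ : ∀ z, 0 ≤ Z z) {a' a : ℤ}
    (hsub : ∀ k : ℤ, (δ : ℂ) * hexMidpoint (floorEdge k M) ∈ S → a' ≤ k ∧ k < a) :
    ∑ᶠ k ∈ {k : ℤ | (δ : ℂ) * hexMidpoint
        s((((![k, M - 1] : Site 2)), (1 : Fin 2)), ((![k, M] : Site 2), (0 : Fin 2))) ∈ S},
        Z s((((![k, M - 1] : Site 2)), (1 : Fin 2)), ((![k, M] : Site 2), (0 : Fin 2))) ≤
      ∑ k ∈ Finset.Ico a' a, Z (floorEdge k M) := by
  have hsub' : {k : ℤ | (δ : ℂ) * hexMidpoint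
      s((((![k, M - 1] : Site 2)), (1 : Fin 2)), ((![k, M] : Site 2), (0 : Fin 2))) ∈ S} ⊆
      ↑(Finset.Ico a' a) := fun k hk => by
    rw [Finset.coe_Ico]; exact hsub k hk
  have hfin : {k : ℤ | (δ : ℂ) * hexMidpoint
      s((((![k, M - 1] : Site 2)), (1 : Fin 2)), ((![k, M] : Site 2), (0 : Fin 2))) ∈ S}.Finite :=
    (Finset.finite_toSet _).subset hsub'
  rw [finsum_mem_eq_finite_toFinset_sum _ hfin]
  exact Finset.sum_le_sum_of_subset_of_nonneg (Set.Finite.toFinset_subset.2 hsub') fun k _ _ => hZ _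

section Frame

/-! ### The frame of the root and of the normaliser, eventually -/

variable {D : DobrushinDomain} {ρ : ℝ} {Λ : ℝ → Finset HexVertex} {m : ℝ → ℤ} {b : ℝ → Sym2 HexVertex}
  (hAF : 0 < ρ ∧
    D.carrier ∩ Metric.ball (D.pt 1) ρ = {z : ℂ | (D.pt 1).im < z.im} ∩ Metric.ball (D.pt 1) ρ ∧
    (∀ᶠ δ : ℝ in 𝓝[>] 0, hexDomainSimplyConnected (Λ δ) ∧ b δ ∈ hexDomainBoundary (Λ δ) ∧
      (hexGraph.induce ((Λ δ : Finset HexVertex) : Set HexVertex)).Preconnected ∧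
      (∀ v ∈ Λ δ, (δ : ℂ) * hexCenter v ∈ D.carrier) ∧
      (∀ v : HexVertex, (δ : ℂ) * hexCenter v ∈ Metric.ball (D.pt 1) ρ →
        (v ∈ Λ δ ↔ m δ ≤ v.1 1))) ∧
    (∀ K : Set ℂ, IsCompact K → K ⊆ D.carrier →
      ∀ᶠ δ : ℝ in 𝓝[>] 0, ∀ v : HexVertex, (δ : ℂ) * hexCenter v ∈ K → v ∈ Λ δ) ∧
    Tendsto (fun δ : ℝ => (δ : ℂ) * hexMidpoint (b δ)) (𝓝[>] 0) (𝓝 (D.pt 1)))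
  {x : ℂ} {e : ℝ → Sym2 HexVertex} {r : ℝ} {mr : ℝ → ℤ}
  (hPR : 0 < r ∧ D.carrier ∩ Metric.ball x r = {z : ℂ | x.im < z.im} ∩ Metric.ball x r ∧
    (∀ᶠ δ : ℝ in 𝓝[>] 0, e δ ∈ hexDomainBoundary (Λ δ) ∧
      Nonempty (HexMidEdgeSAW (Λ δ) (e δ) (b δ)) ∧
      (∀ v : HexVertex, (δ : ℂ) * hexCenter v ∈ Metric.ball x r → (v ∈ Λ δ ↔ mr δ ≤ v.1 1))) ∧
    Tendsto (fun δ : ℝ => (δ : ℂ) * hexMidpoint (e δ)) (𝓝[>] 0) (𝓝 x))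
  (hx : x ≠ D.pt 1)

include hAF hPR

omit hAF in
/-- **The root frame is near `x`, eventually**: for `ε > 0`, eventually `‖δ·mid(e δ) − x‖ < ε`,
the root floor line `im = δ·mr δ·√3/2` lies above `im x − δ√3/6` and within `ε` of `im x`.
[cite: DuminilCopinSmirnov2012, §3 (the boundary part α of the strip)] -/
theorem rootFrame_near (hΛΩ : ∀ᶠ δ : ℝ in 𝓝[>] 0, ∀ v ∈ Λ δ, (δ : ℂ) * hexCenter v ∈ D.carrier)
    {ε : ℝ} (hε : 0 < ε) :
    ∀ᶠ δ : ℝ in 𝓝[>] 0, ‖(δ : ℂ) * hexMidpoint (e δ) - x‖ < ε ∧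
      x.im < δ * ((mr δ : ℝ) * (Real.sqrt 3 / 2) + Real.sqrt 3 / 6) ∧
      |δ * (mr δ : ℝ) * (Real.sqrt 3 / 2) - x.im| < ε :=
  (pinned_frame hPR.1 hε hPR.2.1 (hPR.2.2.1.mono fun _ h => h.2.2) (hPR.2.2.1.mono fun _ h => h.1) hΛΩ
    hPR.2.2.2).mono fun _ h => h.2

omit hPR in
/-- **The gate frame is near `pt 1`, eventually** (the same at the normaliser).
[cite: DuminilCopinSmirnov2012, §3 (the boundary part α of the strip)] -/
theorem gateFrame_near {ε : ℝ} (hε : 0 < ε) :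
    ∀ᶠ δ : ℝ in 𝓝[>] 0, ‖(δ : ℂ) * hexMidpoint (b δ) - D.pt 1‖ < ε ∧
      (D.pt 1).im < δ * ((m δ : ℝ) * (Real.sqrt 3 / 2) + Real.sqrt 3 / 6) ∧
      |δ * (m δ : ℝ) * (Real.sqrt 3 / 2) - (D.pt 1).im| < ε :=
  (pinned_frame hAF.1 hε hAF.2.1 (hAF.2.2.1.mono fun _ h => h.2.2.2.2) (hAF.2.2.1.mono fun _ h => h.2.1)
    (hAF.2.2.1.mono fun _ h => h.2.2.2.1) hAF.2.2.2.2).mono fun _ h => h.2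

include hx

/-- **The root and the normaliser are floor darts, eventually.**  Eventually as `δ → 0+`: the root
is `e δ = floorEdge ka (mr δ)` with `upFace ka (mr δ) ∈ Λ δ`, `belowFace ka (mr δ) ∉ Λ δ`; the
normaliser is `b δ = floorEdge kb (m δ)` with the same two face facts; the two darts differ; and a
self-avoiding walk `root → normaliser` exists, of winding `π + 2πj` for an integer `j`.
[cite: DuminilCopinSmirnov2012, §3 (the boundary part α of the strip)] -/
theorem eventually_rootGateFrame :
    ∀ᶠ δ : ℝ in 𝓝[>] 0, ∃ (ka kb j : ℤ)
      (γb : HexMidEdgeSAW (Λ δ) (floorEdge ka (mr δ)) (floorEdge kb (m δ))),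
      e δ = floorEdge ka (mr δ) ∧ b δ = floorEdge kb (m δ) ∧
      upFace ka (mr δ) ∈ Λ δ ∧ belowFace ka (mr δ) ∉ Λ δ ∧
      upFace kb (m δ) ∈ Λ δ ∧ belowFace kb (m δ) ∉ Λ δ ∧
      floorEdge kb (m δ) ≠ floorEdge ka (mr δ) ∧
      γb.winding = Real.pi + 2 * Real.pi * j := by
  obtain ⟨hρ, hcar, hev, -, hblim⟩ := hAF
  obtain ⟨hr, hcarx, hevx, helim⟩ := hPR
  have hΛΩ := hev.mono fun _ h => h.2.2.2.1
  have hxp : 0 < ‖x - D.pt 1‖ := norm_pos_iff.2 (sub_ne_zero.2 hx)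
  set ε : ℝ := min (min r ρ) ‖x - D.pt 1‖ / 4 with hεdef
  have hmin : 0 < min (min r ρ) ‖x - D.pt 1‖ := lt_min (lt_min hr hρ) hxp
  have hε : 0 < ε := by positivity
  have hεr : 4 * ε ≤ r := by
    have := (min_le_left (min r ρ) ‖x - D.pt 1‖).trans (min_le_left r ρ); rw [hεdef]; linarith
  have hερ : 4 * ε ≤ ρ := by
    have := (min_le_left (min r ρ) ‖x - D.pt 1‖).trans (min_le_right r ρ); rw [hεdef]; linarith
  have hεx : 4 * ε ≤ ‖x - D.pt 1‖ := by
    have := min_le_right (min r ρ) ‖x - D.pt 1‖; rw [hεdef]; linarith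
  have hrootF := pinned_frame hr hε hcarx (hevx.mono fun _ h => h.2.2) (hevx.mono fun _ h => h.1) hΛΩ helim
  have hgateF := pinned_frame hρ hε hcar (hev.mono fun _ h => h.2.2.2.2) (hev.mono fun _ h => h.2.1)
    hΛΩ hblim
  have hrootW := flat_window (R' := r / 2) (by linarith) (hevx.mono fun _ h => h.2.2)
    (hevx.mono fun _ h => h.1) helim
  have hgateW := flat_window (R' := ρ / 2) (by linarith) (hev.mono fun _ h => h.2.2.2.2)
    (hev.mono fun _ h => h.2.1) hblim
  have hδev : ∀ᶠ δ : ℝ in 𝓝[>] 0, δ ∈ Set.Ioo 0 ε := Ioo_mem_nhdsGT hε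
  filter_upwards [hrootF, hgateF, hrootW, hgateW, hevx, hδev] with δ ⟨⟨ka, hka⟩, hnear, _, _⟩
    ⟨⟨kb, hkb⟩, hnearb, _, _⟩ hWr hWg hevxδ ⟨hδ0, hδε⟩
  -- the columns of the two darts lie in the windows
  have hcol : ∀ (k M : ℤ) (c : ℂ) (dd : Sym2 HexVertex), dd = floorEdge k M →
      ‖(δ : ℂ) * hexMidpoint dd - c‖ < ε → |δ * (k + M / 2) - c.re| ≤ 2 * ε := by
    intro k M c dd hdd hn
    rw [hdd] at hn
    have h1 := Complex.abs_re_le_norm ((δ : ℂ) * hexMidpoint (floorEdge k M) - c)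
    rw [Complex.sub_re, re_scaled_hexMidpoint_floorEdge] at h1
    have h2 : |δ * (↑k + ↑M / 2) + δ / 2 - c.re| < ε := lt_of_le_of_lt h1 hn
    rw [abs_le]; rw [abs_lt] at h2; constructor <;> linarith
  obtain ⟨hUa, hBa, -, -⟩ := hWr ka ((hcol ka (mr δ) x (e δ) hka hnear).trans (by linarith))
  obtain ⟨hUb, hBb, -, -⟩ := hWg kb ((hcol kb (m δ) (D.pt 1) (b δ) hkb hnearb).trans (by linarith))
  have hneb : floorEdge kb (m δ) ≠ floorEdge ka (mr δ) := by
    intro heq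
    have h1 : (δ : ℂ) * hexMidpoint (b δ) = (δ : ℂ) * hexMidpoint (e δ) := by rw [hkb, hka, heq]
    rw [h1] at hnearb
    have : ‖x - D.pt 1‖ < 2 * ε := by
      calc ‖x - D.pt 1‖ ≤ ‖(δ : ℂ) * hexMidpoint (e δ) - x‖ + ‖(δ : ℂ) * hexMidpoint (e δ) - D.pt 1‖ := by
            rw [norm_sub_rev ((δ : ℂ) * hexMidpoint (e δ)) x]; exact norm_sub_le_norm_sub_add_norm_sub _ _ _
        _ < 2 * ε := by linarith
    linarith
  obtain ⟨γ⟩ := hevxδ.2.1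
  rw [hka, hkb] at γ
  obtain ⟨j, hj⟩ := exists_winding_floorDarts_eq hBa hBb hneb γ
  exact ⟨ka, kb, j, γ, hka, hkb, hUa, hBa, hUb, hBb, hneb, hj⟩

/-- **One winding class is hit frequently along a mesh sequence.**  Along `ns → 0+` there is an
integer `j₀` such that frequently in `n`, at scale `δ = ns n`, the frame of
`eventually_rootGateFrame` holds with a walk `γ_b : root → normaliser` whose winding is
`π + 2πj`, `j ≡ j₀ (mod 8)` (pigeonhole over `ZMod 8`). [folklore] -/
theorem frequently_armClass {ns : ℕ → ℝ} (hns : Tendsto ns atTop (𝓝[>] 0)) :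
    ∃ j₀ : ℤ, ∃ᶠ n : ℕ in atTop, ∃ (ka kb j : ℤ)
      (γb : HexMidEdgeSAW (Λ (ns n)) (floorEdge ka (mr (ns n))) (floorEdge kb (m (ns n)))),
      e (ns n) = floorEdge ka (mr (ns n)) ∧ b (ns n) = floorEdge kb (m (ns n)) ∧
      upFace ka (mr (ns n)) ∈ Λ (ns n) ∧ belowFace ka (mr (ns n)) ∉ Λ (ns n) ∧
      upFace kb (m (ns n)) ∈ Λ (ns n) ∧ belowFace kb (m (ns n)) ∉ Λ (ns n) ∧
      floorEdge kb (m (ns n)) ≠ floorEdge ka (mr (ns n)) ∧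
      γb.winding = Real.pi + 2 * Real.pi * j ∧ (j : ZMod 8) = (j₀ : ZMod 8) := by
  have hev : ∀ᶠ n : ℕ in atTop, ∃ c : ZMod 8, ∃ (ka kb j : ℤ)
      (γb : HexMidEdgeSAW (Λ (ns n)) (floorEdge ka (mr (ns n))) (floorEdge kb (m (ns n)))),
      e (ns n) = floorEdge ka (mr (ns n)) ∧ b (ns n) = floorEdge kb (m (ns n)) ∧
      upFace ka (mr (ns n)) ∈ Λ (ns n) ∧ belowFace ka (mr (ns n)) ∉ Λ (ns n) ∧
      upFace kb (m (ns n)) ∈ Λ (ns n) ∧ belowFace kb (m (ns n)) ∉ Λ (ns n) ∧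
      floorEdge kb (m (ns n)) ≠ floorEdge ka (mr (ns n)) ∧
      γb.winding = Real.pi + 2 * Real.pi * j ∧ (j : ZMod 8) = c := by
    filter_upwards [hns.eventually (eventually_rootGateFrame hAF hPR hx)] with n
      ⟨ka, kb, j, γb, h1, h2, h3, h4, h5, h6, h7, h8⟩
    exact ⟨(j : ZMod 8), ka, kb, j, γb, h1, h2, h3, h4, h5, h6, h7, h8, rfl⟩
  obtain ⟨c, hc⟩ := exists_frequently_of_eventually_exists hev
  refine ⟨((c.val : ℕ) : ℤ), hc.mono fun n ⟨ka, kb, j, γb, h1, h2, h3, h4, h5, h6, h7, h8, h9⟩ =>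
    ⟨ka, kb, j, γb, h1, h2, h3, h4, h5, h6, h7, h8, ?_⟩⟩
  rw [h9, Int.cast_natCast, ZMod.natCast_zmod_val]

end Frame

end Summit.CriticalPhenomena.SAWScalingLimit.Theorems.PickHalfPlane.BoundaryDataTransfer

end
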